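import Summits.QuantumFields.YangMills.Theorems.IR.Negative.OnsetUcFalseOfMonopoleWire
import Summits.QuantumFields.YangMills.Theorems.BalabanLadderIROnsetBootstrap
import Summits.QuantumFields.YangMills.Theorems.IR.AfPincerUcSupplier
import HarnessLib

/-!
# Crux `IR` (stmt-QuantumFields-19354), slot `af-pincer-Uc` after the «SC ∕ NSC split» (owner R89, registry write #5,
# sha16 d9d9d710e4ae01bd): the lead's reductions RE-KEYED to the reshaped stub `stub_onsetUcSC : OnsetMixingTypicalUKPcSC`

Helper module for item `stmt-QuantumFields-19354` (`--supports`; it closes nothing); lead prover of the line.  Route-independent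
(tree constants `OnsetFormats.UnivShellCond` / `OnsetMixing`, `OnsetFormatsUc.TypShellCondUKPc` / `OnsetMixingTypicalUKPcSC`, the lead's
`AfPincerUc.Supplier.*` and `AfPincerUc.Bootstrap.*`).

The disprover's monopole wire (`Theorems/IR/Negative/OnsetUcFalseOfMonopoleWire`, p521601) kills the old statement
`OnsetMixingTypicalUKPc` (typed over ALL compact simple `G`) on the non-simply-connected family; the registered stub is now the
repaired C′ `OnsetFormatsUc.OnsetMixingTypicalUKPcSC` (hypothesis `SimplyConnectedSpace G`).  Every reduction the lead landed for
the old statement (p518433 `onsetMixingTypicalUKPc_of_clauseI_supCellRarity` / `_of_workingClass`, p522910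
`onsetMixingTypicalUKPc_of_onsetMixing`) restricts to the SC family by threading one hypothesis; this file does it once, through
PER-GROUP lemmas that serve any family of groups:

* §1 `typOnsetAt_of_clauseI_supCellRarity` — at fixed `(G, ρ)`, `(n, ε)`: «∀δ ∃β₂ ∀β ∃b ∃ frame-covariant cell-local `Typ` with
  clause (i) at the centre and any-exterior single-cell rarity δ» ⇒ «∀δ ∃β₂ ∀β ∃b, `TypShellCondUKPc ρ β b n ε δ`»
  (`typShellCondUKPc_of_covariant_supCellRarity`); `typOnsetAt_of_univOnsetAt` — at fixed `(G, ρ)`: a universal onset with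
  `ε · shellCount n < 1` ⇒ a Uc onset with the engine constant `≤ 3/4` (bootstrap `univShellCond_bootstrap` + `exists_bootstrap_exponent`).
* §2 the SC statements: `onsetMixingTypicalUKPcSC_of_clauseI_supCellRaritySC`, `onsetMixingTypicalUKPcSC_of_workingClassSC`
  (hypotheses asked ONLY for simply connected `G`), `onsetMixingTypicalUKPcSC_of_univOnsetSC` (an SC-restricted universal onset
  suffices) and `onsetMixingTypicalUKPcSC_of_onsetMixing : OnsetMixing → OnsetMixingTypicalUKPcSC`.

So the census of the LEAD's stub reads, after R89: `stub_onsetUcSC` ⇐ «clause (i) for the working class at a β-dependent mesh,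
budget met» on SIMPLY CONNECTED compact simple `G` (research content, not claimed) — or ⇐ crux 16178 (sibling `AfPincerUcOfCALS`).
HONEST FRAMING: re-keying of implications among OPEN statements; not a gap, not Clay.  No `sorry`; axioms ⊆ {propext,
Classical.choice, Quot.sound}.
-/

set_option autoImplicit false

noncomputable section

open Filter Topology MeasureTheory
open Literature.MathematicalPhysics.QuantumFieldTheory Literature.MathematicalPhysics.QuantumLattice
open Summit.QuantumFields.YangMills.Cruxes.IR.FixedMesh (ClauseI)
open Summit.QuantumFields.YangMills.Cruxes.IR.OnsetFormats (shellCount UnivShellCond OnsetMixing)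
open Summit.QuantumFields.YangMills.Cruxes.IR.OnsetFormatsUc (IsFrame TypLocal TypShellCondUKPc OnsetMixingTypicalUKPcSC
  typShellCondUKPc_of_univShellCond)
open Summit.QuantumFields.YangMills.Theorems.IRTypLocalExcess (FrameCovariant WorkingClass frameCovariant_workingClass
  typLocal_workingClass)
open Summit.QuantumFields.YangMills.Cruxes.IR.AfPincerUc.Supplier (SupCellRarityAt typShellCondUKPc_of_covariant_supCellRarity)
open Summit.QuantumFields.YangMills.Cruxes.IR.AfPincerUc.Bootstrap (univShellCond_bootstrap exists_bootstrap_exponent)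

namespace Summit.QuantumFields.YangMills.Cruxes.IR.AfPincerUc.SupplierSC

/-! ## §1 Per-group reductions -/

section PerGroup

variable {G : Type} [Group G] [TopologicalSpace G] [IsTopologicalGroup G] [CompactSpace G]
  [MeasurableSpace G] [BorelSpace G] [T2Space G] [SecondCountableTopology G]
  {N : ℕ} {ρ : G →* Matrix (Fin N) (Fin N) ℂ}

/-- **Per group: clause (i) + single-cell rarity at the onset ⇒ the Uc onset clause** (same `(n, ε)`). -/
theorem typOnsetAt_of_clauseI_supCellRarity (hρ : Continuous ρ) {n : ℕ} {ε : ℝ}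
    (h : ∀ δ : ℝ, 0 < δ → ∃ β₂ : ℝ, ∀ β : ℝ, β₂ ≤ β → ∃ b : ℕ, 1 ≤ b ∧
      ∃ Typ : (Fin 4 → ℤ → ℤ) → (Fin 4 → ℤ) → Set (LGConfig 4 G), FrameCovariant Typ ∧
        ∀ w : Fin 4 → ℤ → ℤ, IsFrame b w →
          TypLocal w (Typ w) ∧ ClauseI ρ β w n ε (Typ w) ∧ SupCellRarityAt ρ β w (Typ w) δ) :
    ∀ δ : ℝ, 0 < δ → ∃ β₂ : ℝ, ∀ β : ℝ, β₂ ≤ β → ∃ b : ℕ, 1 ≤ b ∧ TypShellCondUKPc ρ β b n ε δ := by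
  intro δ hδ
  obtain ⟨β₂, hβ⟩ := h δ hδ
  refine ⟨β₂, fun β hb => ?_⟩
  obtain ⟨b, hb1, Typ, hcov, hw⟩ := hβ β hb
  exact ⟨b, hb1, typShellCondUKPc_of_covariant_supCellRarity hρ β hb1 hδ.le hcov hw⟩

/-- **Per group: a universal onset with the Dobrushin–Shlosman threshold ⇒ a Uc onset with the engine constant**:
`ε · shellCount n < 1` and «∃β₂ ∀β≥β₂ ∃b≥1, UnivShellCond ρ β b n ε» give an admissible `(n', ε')`, `ε' · shellCount n' ≤ 3/4`,
with «∀δ ∃β₂ ∀β≥β₂ ∃b≥1, TypShellCondUKPc ρ β b n' ε' δ» (bootstrap to window `j(2n+1)`, class `Typ ≡ univ`). -/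
theorem typOnsetAt_of_univOnsetAt (hρ : Continuous ρ) {n : ℕ} {ε : ℝ} (hε : 0 ≤ ε) (hlt : ε * shellCount n < 1)
    (h : ∃ β₂ : ℝ, ∀ β : ℝ, β₂ ≤ β → ∃ b : ℕ, 1 ≤ b ∧ UnivShellCond ρ β b n ε) :
    ∃ (n' : ℕ) (ε' : ℝ), 1 ≤ n' ∧ 0 ≤ ε' ∧ ε' * shellCount n' ≤ 3 / 4 ∧
      ∀ δ : ℝ, 0 < δ → ∃ β₂ : ℝ, ∀ β : ℝ, β₂ ≤ β → ∃ b : ℕ, 1 ≤ b ∧ TypShellCondUKPc ρ β b n' ε' δ := by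
  obtain ⟨β₂, hβ⟩ := h
  have hq0 : 0 ≤ ε * shellCount n := by
    unfold Summit.QuantumFields.YangMills.Cruxes.IR.OnsetFormats.shellCount
    positivity
  obtain ⟨j, hj1, hj⟩ := exists_bootstrap_exponent hq0 hlt n
  refine ⟨j * (2 * n + 1), (ε * shellCount n) ^ j, ?_, pow_nonneg hq0 j, hj, fun δ _ => ⟨β₂, fun β hb => ?_⟩⟩
  · calc 1 ≤ j := hj1
      _ ≤ j * (2 * n + 1) := Nat.le_mul_of_pos_right j (by omega)
  · obtain ⟨b, hb1, hU⟩ := hβ β hb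
    exact ⟨b, hb1, typShellCondUKPc_of_univShellCond (univShellCond_bootstrap ρ hρ hb1 hε hU j) δ⟩

end PerGroup

/-! ## §2 The reshaped stub `OnsetMixingTypicalUKPcSC` from SC-restricted hypotheses -/

/-- **SC form of the reduction of record:** clause (i) + single-cell rarity at the onset, asked ONLY for simply connected compact
simple `G`, gives `OnsetMixingTypicalUKPcSC`. -/
theorem onsetMixingTypicalUKPcSC_of_clauseI_supCellRaritySC
    (h : ∀ (G : Type) [Group G] [TopologicalSpace G] [IsTopologicalGroup G] [CompactSpace G],
      IsCompactSimpleLieGroup G → SimplyConnectedSpace G →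
      letI : MeasurableSpace G := borel G; haveI : BorelSpace G := ⟨rfl⟩;
      ∀ r : LatticeRep G, ∃ (n : ℕ) (ε : ℝ), 1 ≤ n ∧ 0 ≤ ε ∧ ε * shellCount n ≤ 3 / 4 ∧
        ∀ δ : ℝ, 0 < δ → ∃ β₂ : ℝ, ∀ β : ℝ, β₂ ≤ β → ∃ b : ℕ, 1 ≤ b ∧
          ∃ Typ : (Fin 4 → ℤ → ℤ) → (Fin 4 → ℤ) → Set (LGConfig 4 G), FrameCovariant Typ ∧
            ∀ w : Fin 4 → ℤ → ℤ, IsFrame b w →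
              TypLocal w (Typ w) ∧ ClauseI r.ρ β w n ε (Typ w) ∧ SupCellRarityAt r.ρ β w (Typ w) δ) :
    OnsetMixingTypicalUKPcSC := by
  intro G _ _ _ _ hG hsc
  letI : MeasurableSpace G := borel G
  haveI : BorelSpace G := ⟨rfl⟩
  intro r
  haveI : T2Space G := T2Space.of_injective_continuous r.injective r.continuous
  haveI : SecondCountableTopology G :=
    (r.continuous.isClosedEmbedding r.injective).isEmbedding.secondCountableTopology
  obtain ⟨n, ε, hn, hε, hM, hrest⟩ := h G hG hsc r
  exact ⟨n, ε, hn, hε, hM, typOnsetAt_of_clauseI_supCellRarity r.continuous hrest⟩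

/-- **SC form of the working-class reduction:** clause (i) for `WorkingClass = diluteTyp ∩ Typ_lx^int` at a β-dependent mesh with its
any-exterior rarity budget met, asked ONLY for simply connected compact simple `G`, gives `OnsetMixingTypicalUKPcSC`
(`stub_onsetUcSC`'s statement).  The rarity conjunct is the explicit inequality `workingBudget ≤ δ` of
`Theorems/BalabanLadderIRWorkingClassBudget`; the clause-(i) conjunct is the research content. -/
theorem onsetMixingTypicalUKPcSC_of_workingClassSC
    (h : ∀ (G : Type) [Group G] [TopologicalSpace G] [IsTopologicalGroup G] [CompactSpace G],
      IsCompactSimpleLieGroup G → SimplyConnectedSpace G →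
      letI : MeasurableSpace G := borel G; haveI : BorelSpace G := ⟨rfl⟩;
      ∀ r : LatticeRep G, ∃ (n : ℕ) (ε : ℝ), 1 ≤ n ∧ 0 ≤ ε ∧ ε * shellCount n ≤ 3 / 4 ∧
        ∀ δ : ℝ, 0 < δ → ∃ β₂ : ℝ, ∀ β : ℝ, β₂ ≤ β → ∃ b : ℕ, 1 ≤ b ∧
          ∃ (ℓ : ℕ) (T : ℝ) (Rs : Set ℕ) (E : ℕ → ℝ), ∀ w : Fin 4 → ℤ → ℤ, IsFrame b w →
            ClauseI r.ρ β w n ε (WorkingClass r.ρ ℓ T Rs E w) ∧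
              SupCellRarityAt r.ρ β w (WorkingClass r.ρ ℓ T Rs E w) δ) :
    OnsetMixingTypicalUKPcSC := by
  refine onsetMixingTypicalUKPcSC_of_clauseI_supCellRaritySC fun G _ _ _ _ hG hsc => ?_
  letI : MeasurableSpace G := borel G
  haveI : BorelSpace G := ⟨rfl⟩
  intro r
  haveI : T2Space G := T2Space.of_injective_continuous r.injective r.continuous
  haveI : SecondCountableTopology G :=
    (r.continuous.isClosedEmbedding r.injective).isEmbedding.secondCountableTopology
  obtain ⟨n, ε, hn, hε, hM, hrest⟩ := h G hG hsc r
  refine ⟨n, ε, hn, hε, hM, fun δ hδ => ?_⟩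
  obtain ⟨β₂, hβ⟩ := hrest δ hδ
  refine ⟨β₂, fun β hb => ?_⟩
  obtain ⟨b, hb1, ℓ, T, Rs, E, hw⟩ := hβ β hb
  exact ⟨b, hb1, WorkingClass r.ρ ℓ T Rs E, frameCovariant_workingClass r.ρ ℓ T Rs E,
    fun w hw' => ⟨typLocal_workingClass r.ρ r.continuous ℓ T Rs E w, hw w hw'⟩⟩

/-- **An SC-restricted universal onset suffices:** «for every simply connected compact simple `G` and `r`, some `(n, ε)` with
`ε · shellCount n < 1` and a universal mixing mesh at all large `β`» ⇒ `OnsetMixingTypicalUKPcSC` (bootstrap, class `univ`). -/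
theorem onsetMixingTypicalUKPcSC_of_univOnsetSC
    (h : ∀ (G : Type) [Group G] [TopologicalSpace G] [IsTopologicalGroup G] [CompactSpace G],
      IsCompactSimpleLieGroup G → SimplyConnectedSpace G →
      letI : MeasurableSpace G := borel G; haveI : BorelSpace G := ⟨rfl⟩;
      ∀ r : LatticeRep G, ∃ (n : ℕ) (ε : ℝ), 1 ≤ n ∧ 0 ≤ ε ∧ ε * shellCount n < 1 ∧
        ∃ β₂ : ℝ, ∀ β : ℝ, β₂ ≤ β → ∃ b : ℕ, 1 ≤ b ∧ UnivShellCond r.ρ β b n ε) :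
    OnsetMixingTypicalUKPcSC := by
  intro G _ _ _ _ hG hsc
  letI : MeasurableSpace G := borel G
  haveI : BorelSpace G := ⟨rfl⟩
  intro r
  haveI : T2Space G := T2Space.of_injective_continuous r.injective r.continuous
  haveI : SecondCountableTopology G :=
    (r.continuous.isClosedEmbedding r.injective).isEmbedding.secondCountableTopology
  obtain ⟨n, ε, -, hε, hlt, hrest⟩ := h G hG hsc r
  exact typOnsetAt_of_univOnsetAt r.continuous hε hlt hrest

/-- **`OnsetMixing → OnsetMixingTypicalUKPcSC`**: the expired universal stub (all compact simple `G`) implies the reshaped one. -/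
theorem onsetMixingTypicalUKPcSC_of_onsetMixing (h : OnsetMixing) : OnsetMixingTypicalUKPcSC :=
  onsetMixingTypicalUKPcSC_of_univOnsetSC fun G _ _ _ _ hG _ => h G hG

end Summit.QuantumFields.YangMills.Cruxes.IR.AfPincerUc.SupplierSC

end
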